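import Literature.MathematicalPhysics.QuantumFieldTheory.Balaban1983to89.B9Eq326AbelianRecordLettersZdPer
import Literature.MathematicalPhysics.QuantumFieldTheory.Balaban1983to89.B9Thm311FlatCoercivityAllLettersZdPer

/-!
# `Balaban1983to89.B9Thm311AbelianUniformZdPer` — [Balaban1985BackgroundPropagators] THEOREM 3.11 p. 416 («uniformly in U, Ω_j») FOR THE GENUINE PERIODIC RECORD AT A
# COMMUTATIVE COEFFICIENT ALGEBRA, ON THE ALL-TORUS MEMBERS, WITH A VOLUME-UNIFORM THRESHOLD AND CONSTANT: (§1, any algebra) the curvature pairing is dominated,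
# `|⟨A, Δ′(U₀)A⟩_per| ≤ 14(d−1)·α·(Lᵐη)⁻²·d(d+1)²·(C_τ∕κ)·Σ|A|²_τ` ((3.69) pointwise + a Schur count); (§2) with `Δ_a(U₀) = Δ_a(1) + Δ′(U₀)` (commutativity,
# `B9Eq326AbelianRecordLettersZdPer`) and dag-n06-w3's volume-uniform flat coercivity, `(γ − c_Dα₀)·Σ|A|²_τ ≤ ⟨A, Δ_a(U₀)A⟩_per` at EVERY class background of EVERY
# period — hence `RegularAtHPer` and the N05 head's binder `InvAtHIPer` with a threshold `a_ab` INDEPENDENT OF THE VOLUME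

statement-level skeleton of published theorems with citation tags; proofs where landed; nothing here is a claim about the Yang–Mills mass gap

`[Balaban1985BackgroundPropagators]` ("B9", CMP **99** (1985) 389–434): Thm 3.11 p. 416 *«the operators Δ′_a, G′, …, Δ_a, G are positive definite … uniformly in U, Ω_j»*, (3.10)
p. 392, (3.26)–(3.27) p. 395, (3.69) p. 404.  `[Balaban1984PropagatorsI]` ("B5") Prop. 1.1 (1.90) p. 33 (the flat coercivity, via dag-n06-w3).  `[Balaban1985RegularSpaces]`
("B8", CMP **99**): (1.7) p. 77, (1.58) p. 86, p. 77 *«Ω_j = T_η»*.  PDF held: `paper:balaban1985-cmp99-background-propagators` pp. 392, 395, 404, 416 (re-read 2026-08-29).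

CITATION HEADER (lean-in-tree rule).  Cell `pub-ymgap` (YM Track A), DAG node N06 = [B9], seat `pub-ymgap-dag-n06-b` (g26), the (β′-PERIODIC) road; sequel of this seat's
LOCATED-SELF-10 certificate `B9Eq326AbelianRecordLettersZdPer` (the programme's record `Node00.Record12Numerics.stage3OfRecord₁₂` has `𝔸 := ℂ`).  WHY: every
`InvAtHIPer` of this lineage so far (g24 `B9Thm311ClassCompactnessZdPer`, g25 `…Nested`, g26 `binders_uniform`) has a threshold `a_I(P)` from COMPACTNESS on the period
cell — per period, non-constructive; print's Thm 3.11 is uniform in the volume.  At a commutative coefficient algebra the three background-dependent letters are flat and the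
fourth is `(3.69)`-small, so the volume-uniform statement follows from dag-n06-w3's flat constant `γ = (1∕((d+1)Cst d 1))·min(η w_m L^{2m}∕L^{md}, 1)`
(`bondPairPer_deltaAOf_opsAllZdPer_one_ge`) by a perturbation bound — the first VOLUME-UNIFORM Thm 3.11 statement for the genuine record in the tree, at the
record's algebra.  NOT the non-abelian theorem ([B9] Sects. B–C).

WHAT IS PROVED (kernel, 0 sorry; theorems only — no `def`, no `instance`, no `notation`).
* §1 (ANY `𝔸`): private `norm_le_nearSum` (every side of a plaquette through `⟨x, x+e_μ⟩` is read by the neighbour sum at `x` — the sixteen positions),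
  `sum_cross_le` (`Σ_cell ‖A(x,μ)‖‖A(x+δ,τ)‖ ≤ ½(Σ‖A(·,μ)‖² + Σ‖A(·,τ)‖²)`, the shifted cell sum is the cell sum: dag-n06-b g22's `sum_box_shift`), `sum_norm_mul_nearSum_le`
  (`≤ d(d+1)²·Σ‖A‖²`), ★★ `abs_bondPairPer_DpZd_le` (`U₀` unitary with all plaquettes `α·L^{−2m}`-close, `A` periodic:
  `|⟨A, Δ′(U₀)A⟩_per| ≤ 14(d−1)·α·(Lᵐη)⁻²·d(d+1)²·(C_τ∕κ)·Σ_μΣ_cell Re τ(A*A)`; dag-n06-w2's `norm_DpZd_le_of_plaqSmall` pointwise).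
* §2 (commutative `𝔸`, all-torus member `Ω_j = ℤᵈ`, `Λs m = torusLam m`, `ΛbP m = torusLamb m`, `η·Lᵐ ≤ 1`, `P = Lᵐ·n`, `2 ≤ d`, `2 ≤ L`, faithful tracial Hermitian `τ` with
  Cauchy–Schwarz constant `C_τ` and faithfulness constant `κ`): ★★★ `bondPairPer_deltaAOf_opsAllZdPer_ge_of_comm` (`(γ − c_Dα₀)·Σ Re τ(A*A) ≤ ⟨A, Δ_a(U₀)A⟩_per` for every
  unitary periodic `U₀ ∈ 𝔄_m({ℤᵈ}, α₀)`, `0 ≤ α₀ ≤ α_Q∕L²`, every periodic Hermitian `A`; `c_D = 14(d−1)(Lᵐη)⁻²d(d+1)²C_τ∕κ`), ★★★★ `invAtHIPer_opsAllZdPer_of_comm`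
  (`a_ab ≤ α_Q∕L²`, `a_ab ≤ γ∕(2c_D)` ⟹ `RegularInClassAtHPer P L (opsLandauPer τ P (withDpZd (withQQP τ L ΛbP ops₀))) a_ab M i m ∧ InvAtHIPer P L (opsAllZdPer τ L P ΛbP ops₀) a_ab M i m`
  at `P = Lᵐ·n` for EVERY `n` — the threshold does not depend on `n`).

HONEST SCOPE.  (i) SPECIAL CASE: commutative coefficient algebra (the record's `ℂ`); for non-commutative `𝔸` the letters see the background and nothing here applies.
(ii) All-torus members only (the nested members' `Q*aQ` background-freeness needs the disc conditions on class boxes — not here); the (3.47) block `GlobAtIPer` is NOT made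
volume-uniform here (sup-norm bounds of `G J` need decay, [B9] Sect. C — the `L²` bound `‖G‖ ≤ 2∕γ` is implicit in §2 but not packaged).  (iii) `γ`, `c_D` depend on
`(d, L, m, η·Lᵐ, C_τ, κ)` — not on the period.  (iv) Count-neutral; N06 NOT discharged; K1⁹ NOT closed; counts UNMOVED; one finite `𝕋⁴` programme at fixed `ε`, Bałaban as
printed; nothing continuum ∕ ℝ⁴ ∕ OS ∕ mass gap ∕ Clay.  Unit `pub-ymgap-dag-n06-b` (g26), 2026-08-29; NEW file importing this seat's `B9Eq326AbelianRecordLettersZdPer` and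
dag-n06-w3's `B9Thm311FlatCoercivityAllLettersZdPer`; modifies nothing.  Net new unproved facts: 0.
-/

noncomputable section

namespace Literature.MathematicalPhysics.QuantumFieldTheory.Balaban1983to89.B9Thm311AbelianUniformZdPer

open B7Prop1Explicit B7Prop2Explicit
open B7Prop1Local (InBox loK bondHiK)
open B8Ineq132 (covDerivFwd InAk plaqF BondTouches PlaqTouches)
open B8Eq140Level (IsSide PlaqNear BondNear SideTouches)
open B8LeafModelZd (ZdIdx)
open B9Eq369CurvSmallZd (DpZd norm_DpZd_le_of_plaqSmall)
open B9SupplySockB9P3ZdLetters (OpsZd deltaAOf)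
open B9SupplySockB9P3ZdGammaInAkDpZd (withDpZd)
open B9Eq316AveragingTransposeZd (Reg17 wQ alphaQ alphaQ_pos reg17_of_inAk reg17_mono)
open B9Eq316AveragingTransposeZdPrinted (withQQP)
open B9Eq327GreenZdHermPer (domSubHPer RegularAtHPer InvAtHIPer RegularInClassAtHPer withGopZdHPer bondPairPer sum_box_shift invAtHIPer_withGopZdHPer)
open B9SupplySockB9P3ZdAllLettersZdPer (opsAllZdPer opsLandauPer regularAtHPer_opsAllZdPer_of_pos)
open B9Eq326AbelianRecordLettersZdPer (deltaAOf_opsAllZdPer_eq_one_add_DpZd_of_comm)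
open B9Thm311FlatCoercivityAllLettersZdPer (bondPairPer_deltaAOf_opsAllZdPer_one_ge)
open T4TermwiseTorus (IsPeriodic box tcls tlift tlift_mem_box)

-- `Site` alone could resolve to the torus sites of `Setup.lean`; re-export the `ℤ^d` sites of `B7Prop1Explicit`.
export B7Prop1Explicit (Site)

variable {d : ℕ} {𝔸 : Type*} [CStarAlgebra 𝔸]

/-! ## §1  The curvature pairing `⟨A, Δ′(U₀)A⟩_per` is dominated by `α·(Lᵐη)⁻²·Σ|A|²` (any algebra, every period) -/

section Schur

variable (P : ℕ) [NeZero P]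

omit [NeZero P] in
/-- every side of a plaquette through the bond `⟨x, x+e_μ⟩` is read by the neighbour sum at `x`. [cite: Balaban1985BackgroundPropagators, p.404 after (3.69) (bookkeeping)] -/
private theorem norm_le_nearSum (A : Site d → Fin d → 𝔸) {μ : Fin d} {x y : Site d} {τ : Fin d} (h : BondNear μ x y τ) : ‖A y τ‖ ≤
    (∑ τ' : Fin d, (‖A x τ'‖ + ∑ b : Fin d, ‖A (x + e b) τ'‖ + ∑ a : Fin d, ‖A (x - e a) τ'‖ + ∑ a : Fin d, ∑ b : Fin d, ‖A (x - e a + e b) τ'‖)) := by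
  have h0 : ∀ τ', 0 ≤ ‖A x τ'‖ + ∑ b : Fin d, ‖A (x + e b) τ'‖ + ∑ a : Fin d, ‖A (x - e a) τ'‖ + ∑ a : Fin d, ∑ b : Fin d, ‖A (x - e a + e b) τ'‖ :=
    fun τ' => by positivity
  refine le_trans ?_ (Finset.single_le_sum (f := fun τ' => ‖A x τ'‖ + ∑ b : Fin d, ‖A (x + e b) τ'‖ + ∑ a : Fin d, ‖A (x - e a) τ'‖ +
    ∑ a : Fin d, ∑ b : Fin d, ‖A (x - e a + e b) τ'‖) (fun τ' _ => h0 τ') (Finset.mem_univ τ))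
  have hb : ∀ b : Fin d, ‖A (x + e b) τ‖ ≤ ∑ b' : Fin d, ‖A (x + e b') τ‖ :=
    fun b => Finset.single_le_sum (f := fun b' => ‖A (x + e b') τ‖) (fun _ _ => norm_nonneg _) (Finset.mem_univ b)
  have ha : ∀ a : Fin d, ‖A (x - e a) τ‖ ≤ ∑ a' : Fin d, ‖A (x - e a') τ‖ :=
    fun a => Finset.single_le_sum (f := fun a' => ‖A (x - e a') τ‖) (fun _ _ => norm_nonneg _) (Finset.mem_univ a)
  have hab : ∀ a b : Fin d, ‖A (x - e a + e b) τ‖ ≤ ∑ a' : Fin d, ∑ b' : Fin d, ‖A (x - e a' + e b') τ‖ := fun a b =>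
    le_trans (Finset.single_le_sum (f := fun b' => ‖A (x - e a + e b') τ‖) (fun _ _ => norm_nonneg _) (Finset.mem_univ b))
      (Finset.single_le_sum (f := fun a' => ∑ b' : Fin d, ‖A (x - e a' + e b') τ‖) (fun _ _ => Finset.sum_nonneg fun _ _ => norm_nonneg _)
        (Finset.mem_univ a))
  have h1 : 0 ≤ ‖A x τ‖ := norm_nonneg _
  have h2 : 0 ≤ ∑ b : Fin d, ‖A (x + e b) τ‖ := Finset.sum_nonneg fun _ _ => norm_nonneg _
  have h3 : 0 ≤ ∑ a : Fin d, ‖A (x - e a) τ‖ := Finset.sum_nonneg fun _ _ => norm_nonneg _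
  have h4 : 0 ≤ ∑ a : Fin d, ∑ b : Fin d, ‖A (x - e a + e b) τ‖ := Finset.sum_nonneg fun _ _ => Finset.sum_nonneg fun _ _ => norm_nonneg _
  obtain ⟨z, κ, ν, ⟨-, hx⟩, hy⟩ := h
  -- `z` in terms of `x` (four positions of the bond among the sides of `p_{κν}(z)`), then `y` among the four sides
  have hz : z = x ∨ z = x - e κ ∨ z = x - e ν := by
    rcases hx with ⟨hxz, -⟩ | ⟨hxz, -⟩ | ⟨hxz, -⟩ | ⟨hxz, -⟩
    · exact Or.inl hxz.symm
    · exact Or.inr (Or.inl (by rw [hxz, add_sub_cancel_right]))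
    · exact Or.inr (Or.inr (by rw [hxz, add_sub_cancel_right]))
    · exact Or.inl hxz.symm
  have hy' : y = z ∨ y = z + e κ ∨ y = z + e ν := by
    rcases hy with ⟨hyz, -⟩ | ⟨hyz, -⟩ | ⟨hyz, -⟩ | ⟨hyz, -⟩
    · exact Or.inl hyz
    · exact Or.inr (Or.inl hyz)
    · exact Or.inr (Or.inr hyz)
    · exact Or.inl hyz
  rcases hz with hz | hz | hz <;> rcases hy' with hyz | hyz | hyz <;> rw [hyz, hz]
  · linarith
  · linarith [hb κ]
  · linarith [hb ν]
  · linarith [ha κ]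
  · rw [sub_add_cancel]; linarith
  · linarith [hab κ ν]
  · linarith [ha ν]
  · linarith [hab ν κ]
  · rw [sub_add_cancel]; linarith

/-- a cross term over the period cell: `Σ_cell ‖A(x,μ)‖·‖A(x+δ,τ)‖ ≤ ½(Σ_cell ‖A(·,μ)‖² + Σ_cell ‖A(·,τ)‖²)` for a periodic `A` (the shifted cell sum is the cell sum).
[cite: Balaban1985RegularSpaces, p.77 («Ω_j = T_η»; bookkeeping)] -/
private theorem sum_cross_le {A : Site d → Fin d → 𝔸} (hA : IsPeriodic P A) (μ τ : Fin d) (δ : Site d) :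
    ∑ x ∈ box (d := d) P, ‖A x μ‖ * ‖A (x + δ) τ‖ ≤
      (∑ x ∈ box (d := d) P, ‖A x μ‖ ^ 2 + ∑ x ∈ box (d := d) P, ‖A x τ‖ ^ 2) / 2 := by
  have hshift : ∑ x ∈ box (d := d) P, ‖A (x + δ) τ‖ ^ 2 = ∑ x ∈ box (d := d) P, ‖A x τ‖ ^ 2 :=
    sum_box_shift P (g := fun x => ‖A x τ‖ ^ 2) (fun x n => by simp only [hA x n]) δ
  rw [← hshift, le_div_iff₀ (by norm_num : (0 : ℝ) < 2), Finset.sum_mul, ← Finset.sum_add_distrib]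
  refine Finset.sum_le_sum fun x _ => ?_
  nlinarith [sq_nonneg (‖A x μ‖ - ‖A (x + δ) τ‖)]

/-- ★ **THE NEIGHBOUR SUM IS SCHUR-BOUNDED ON THE PERIOD CELL**: `Σ_μ Σ_cell ‖A(x,μ)‖·(neighbour sum at x) ≤ d(d+1)²·Σ_μ Σ_cell ‖A(x,μ)‖²` for a periodic `A`.
[cite: Balaban1985RegularSpaces, p.77 («Ω_j = T_η»; bookkeeping)] -/
private theorem sum_norm_mul_nearSum_le {A : Site d → Fin d → 𝔸} (hA : IsPeriodic P A) :
    ∑ μ : Fin d, ∑ x ∈ box (d := d) P, ‖A x μ‖ *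
        (∑ τ' : Fin d, (‖A x τ'‖ + ∑ b : Fin d, ‖A (x + e b) τ'‖ + ∑ a : Fin d, ‖A (x - e a) τ'‖ + ∑ a : Fin d, ∑ b : Fin d, ‖A (x - e a + e b) τ'‖)) ≤
      ((d : ℝ) * ((d : ℝ) + 1) ^ 2) * ∑ μ : Fin d, ∑ x ∈ box (d := d) P, ‖A x μ‖ ^ 2 := by
  set S : Fin d → ℝ := fun μ => ∑ x ∈ box (d := d) P, ‖A x μ‖ ^ 2 with hS
  have hS0 : ∀ μ, 0 ≤ S μ := fun μ => Finset.sum_nonneg fun _ _ => by positivity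
  set N : ℝ := ∑ μ : Fin d, S μ with hN
  -- the four cross-term families, each `≤ (S μ + S τ)/2` per (μ, τ, offsets)
  have h1 : ∀ μ τ, ∑ x ∈ box (d := d) P, ‖A x μ‖ * ‖A x τ‖ ≤ (S μ + S τ) / 2 := fun μ τ => by
    have := sum_cross_le P hA μ τ 0
    simpa only [add_zero] using this
  have h2 : ∀ μ τ b, ∑ x ∈ box (d := d) P, ‖A x μ‖ * ‖A (x + e b) τ‖ ≤ (S μ + S τ) / 2 := fun μ τ b => sum_cross_le P hA μ τ (e b)
  have h3 : ∀ μ τ a, ∑ x ∈ box (d := d) P, ‖A x μ‖ * ‖A (x - e a) τ‖ ≤ (S μ + S τ) / 2 := fun μ τ a => by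
    have := sum_cross_le P hA μ τ (-e a)
    simpa only [← sub_eq_add_neg] using this
  have h4 : ∀ μ τ a b, ∑ x ∈ box (d := d) P, ‖A x μ‖ * ‖A (x - e a + e b) τ‖ ≤ (S μ + S τ) / 2 := fun μ τ a b => by
    have := sum_cross_le P hA μ τ (-e a + e b)
    simpa only [← add_assoc, ← sub_eq_add_neg] using this
  -- per `(μ, τ)`: the four families of cross terms are `≤ (1 + d + d + d²)·(S μ + S τ)∕2`
  have hμτ : ∀ μ τ, ∑ x ∈ box (d := d) P, (‖A x μ‖ * ‖A x τ‖ + ∑ b : Fin d, ‖A x μ‖ * ‖A (x + e b) τ‖ +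
        ∑ a : Fin d, ‖A x μ‖ * ‖A (x - e a) τ‖ + ∑ a : Fin d, ∑ b : Fin d, ‖A x μ‖ * ‖A (x - e a + e b) τ‖) ≤
      ((d : ℝ) + 1) ^ 2 * ((S μ + S τ) / 2) := by
    intro μ τ
    rw [Finset.sum_add_distrib, Finset.sum_add_distrib, Finset.sum_add_distrib]
    have hb : ∑ x ∈ box (d := d) P, ∑ b : Fin d, ‖A x μ‖ * ‖A (x + e b) τ‖ ≤ (d : ℝ) * ((S μ + S τ) / 2) := by
      rw [Finset.sum_comm]
      calc _ ≤ ∑ b : Fin d, (S μ + S τ) / 2 := Finset.sum_le_sum fun b _ => h2 μ τ b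
        _ = (d : ℝ) * ((S μ + S τ) / 2) := by rw [Finset.sum_const, Finset.card_univ, Fintype.card_fin, nsmul_eq_mul]
    have ha : ∑ x ∈ box (d := d) P, ∑ a : Fin d, ‖A x μ‖ * ‖A (x - e a) τ‖ ≤ (d : ℝ) * ((S μ + S τ) / 2) := by
      rw [Finset.sum_comm]
      calc _ ≤ ∑ a : Fin d, (S μ + S τ) / 2 := Finset.sum_le_sum fun a _ => h3 μ τ a
        _ = (d : ℝ) * ((S μ + S τ) / 2) := by rw [Finset.sum_const, Finset.card_univ, Fintype.card_fin, nsmul_eq_mul]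
    have hab : ∑ x ∈ box (d := d) P, ∑ a : Fin d, ∑ b : Fin d, ‖A x μ‖ * ‖A (x - e a + e b) τ‖ ≤ (d : ℝ) * ((d : ℝ) * ((S μ + S τ) / 2)) := by
      rw [Finset.sum_comm]
      calc _ ≤ ∑ a : Fin d, (d : ℝ) * ((S μ + S τ) / 2) := Finset.sum_le_sum fun a _ => by
              rw [Finset.sum_comm]
              calc _ ≤ ∑ b : Fin d, (S μ + S τ) / 2 := Finset.sum_le_sum fun b _ => h4 μ τ a b
                _ = (d : ℝ) * ((S μ + S τ) / 2) := by rw [Finset.sum_const, Finset.card_univ, Fintype.card_fin, nsmul_eq_mul]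
        _ = (d : ℝ) * ((d : ℝ) * ((S μ + S τ) / 2)) := by rw [Finset.sum_const, Finset.card_univ, Fintype.card_fin, nsmul_eq_mul]
    have hst : 0 ≤ (S μ + S τ) / 2 := by linarith [hS0 μ, hS0 τ]
    nlinarith [h1 μ τ, hb, ha, hab, hst]
  have hd0 : (0 : ℝ) ≤ (d : ℝ) := Nat.cast_nonneg _
  calc ∑ μ : Fin d, ∑ x ∈ box (d := d) P, ‖A x μ‖ * (∑ τ' : Fin d, (‖A x τ'‖ + ∑ b : Fin d, ‖A (x + e b) τ'‖ + ∑ a : Fin d, ‖A (x - e a) τ'‖ + ∑ a : Fin d, ∑ b : Fin d, ‖A (x - e a + e b) τ'‖))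
      = ∑ μ : Fin d, ∑ x ∈ box (d := d) P, ∑ τ : Fin d, (‖A x μ‖ * ‖A x τ‖ + ∑ b : Fin d, ‖A x μ‖ * ‖A (x + e b) τ‖ +
          ∑ a : Fin d, ‖A x μ‖ * ‖A (x - e a) τ‖ + ∑ a : Fin d, ∑ b : Fin d, ‖A x μ‖ * ‖A (x - e a + e b) τ‖) := by
        refine Finset.sum_congr rfl fun μ _ => Finset.sum_congr rfl fun x _ => ?_
        simp only [Finset.mul_sum, mul_add]
    _ = ∑ μ : Fin d, ∑ τ : Fin d, ∑ x ∈ box (d := d) P, (‖A x μ‖ * ‖A x τ‖ + ∑ b : Fin d, ‖A x μ‖ * ‖A (x + e b) τ‖ +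
          ∑ a : Fin d, ‖A x μ‖ * ‖A (x - e a) τ‖ + ∑ a : Fin d, ∑ b : Fin d, ‖A x μ‖ * ‖A (x - e a + e b) τ‖) := by
        refine Finset.sum_congr rfl fun μ _ => ?_
        rw [Finset.sum_comm]
    _ ≤ ∑ μ : Fin d, ∑ τ : Fin d, ((d : ℝ) + 1) ^ 2 * ((S μ + S τ) / 2) :=
        Finset.sum_le_sum fun μ _ => Finset.sum_le_sum fun τ _ => hμτ μ τ
    _ = ((d : ℝ) + 1) ^ 2 / 2 * (∑ μ : Fin d, ∑ τ : Fin d, (S μ + S τ)) := by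
        rw [Finset.mul_sum]
        refine Finset.sum_congr rfl fun μ _ => ?_
        rw [Finset.mul_sum]
        refine Finset.sum_congr rfl fun τ _ => ?_
        ring
    _ = ((d : ℝ) + 1) ^ 2 / 2 * ((d : ℝ) * N + (d : ℝ) * N) := by
        congr 1
        rw [hN]
        simp only [Finset.sum_add_distrib, Finset.sum_const, Finset.card_univ, Fintype.card_fin, nsmul_eq_mul]
        rw [Finset.mul_sum]
    _ = ((d : ℝ) * ((d : ℝ) + 1) ^ 2) * N := by ring

variable (τ : 𝔸 →ₗ[ℂ] ℂ) [Nontrivial 𝔸]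

/-- ★★ **THE CURVATURE PAIRING IS DOMINATED ON THE PERIOD CELL** (any coefficient algebra): for a unitary background with ALL plaquette variables `α·L^{−2m}`-close to `1`
and a `P`-periodic bond field `A`, `|⟨A, Δ′(U₀)A⟩_per| ≤ 14(d−1)·α·(Lᵐη)⁻²·d(d+1)²·(C_τ∕κ)·Σ_μΣ_cell Re τ(A*A)` — [B9] (3.69) pointwise (`norm_DpZd_le_of_plaqSmall`) and a Schur
count over the sides of the plaquettes through each bond (`C_τ`: Cauchy–Schwarz constant of `τ`, `κ`: faithfulness constant `κ‖a‖² ≤ Re τ(a*a)`).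
[cite: Balaban1985BackgroundPropagators, (3.69) p.404, (3.10) p.392, Thm 3.11 p.416; Balaban1985RegularSpaces, (1.7) p.77, p.77 («Ω_j = T_η»)] -/
theorem abs_bondPairPer_DpZd_le {Cτ : ℝ} (hCτ : ∀ x y : 𝔸, |(τ (star x * y)).re| ≤ Cτ * ‖x‖ * ‖y‖) {κ : ℝ} (hκ : 0 < κ)
    (hκle : ∀ a : 𝔸, κ * ‖a‖ ^ 2 ≤ (τ (star a * a)).re) {L m : ℕ} {η α : ℝ} (hα : 0 ≤ α)
    {U₀ : Site d → Fin d → 𝔸ˣ} (hU₀ : ∀ x κ, U₀ x κ ∈ unitaryUnits 𝔸)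
    (hplaq : ∀ (y : Site d) (κ ν : Fin d), κ ≠ ν → ‖plaqF U₀ κ ν y - 1‖ ≤ α * (((L : ℝ) ^ m)⁻¹) ^ 2)
    {A : Site d → Fin d → 𝔸} (hA : IsPeriodic P A) :
    |bondPairPer τ P A (DpZd η U₀ A)| ≤
      (14 * ((d - 1 : ℕ) : ℝ)) * α * (((L : ℝ) ^ m * η) ^ 2)⁻¹ * ((d : ℝ) * ((d : ℝ) + 1) ^ 2) * (Cτ / κ) *
        ∑ μ : Fin d, ∑ x ∈ box (d := d) P, (τ (star (A x μ) * A x μ)).re := by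
  have hCτ0 : 0 ≤ Cτ := by
    have h := hCτ 1 1
    simp only [norm_one, mul_one] at h
    exact le_trans (abs_nonneg _) h
  set K : ℝ := (14 * ((d - 1 : ℕ) : ℝ)) * α * (((L : ℝ) ^ m * η) ^ 2)⁻¹ with hK
  have hK0 : 0 ≤ K := by positivity
  -- pointwise (3.69) with the neighbour sum as the local bound
  have hpt : ∀ (x : Site d) (μ : Fin d), ‖DpZd η U₀ A x μ‖ ≤ K * (∑ τ' : Fin d, (‖A x τ'‖ + ∑ b : Fin d, ‖A (x + e b) τ'‖ + ∑ a : Fin d, ‖A (x - e a) τ'‖ + ∑ a : Fin d, ∑ b : Fin d, ‖A (x - e a + e b) τ'‖)) := fun x μ =>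
    norm_DpZd_le_of_plaqSmall (Ω := (Set.univ : Set (Site d))) hU₀ (L := (L : ℝ)) (j := m)
      (fun y κ ν hκν _ => hplaq y κ ν hκν) A (Or.inl (Set.mem_univ x)) (fun y τ' hn => norm_le_nearSum A hn)
  -- the faithful-trace conversion
  set N : ℝ := ∑ μ : Fin d, ∑ x ∈ box (d := d) P, ‖A x μ‖ ^ 2 with hN
  set T : ℝ := ∑ μ : Fin d, ∑ x ∈ box (d := d) P, (τ (star (A x μ) * A x μ)).re with hT
  have hNT : N ≤ T / κ := by
    rw [le_div_iff₀ hκ, hN, hT, Finset.sum_mul]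
    refine Finset.sum_le_sum fun μ _ => ?_
    rw [Finset.sum_mul]
    exact Finset.sum_le_sum fun x _ => by rw [mul_comm]; exact hκle (A x μ)
  calc |bondPairPer τ P A (DpZd η U₀ A)|
      ≤ ∑ μ : Fin d, ∑ x ∈ box (d := d) P, |(τ (star (A x μ) * DpZd η U₀ A x μ)).re| := by
        unfold bondPairPer
        exact (Finset.abs_sum_le_sum_abs _ _).trans (Finset.sum_le_sum fun μ _ => Finset.abs_sum_le_sum_abs _ _)
    _ ≤ ∑ μ : Fin d, ∑ x ∈ box (d := d) P, Cτ * K * (‖A x μ‖ * (∑ τ' : Fin d, (‖A x τ'‖ + ∑ b : Fin d, ‖A (x + e b) τ'‖ + ∑ a : Fin d, ‖A (x - e a) τ'‖ + ∑ a : Fin d, ∑ b : Fin d, ‖A (x - e a + e b) τ'‖))) := by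
        refine Finset.sum_le_sum fun μ _ => Finset.sum_le_sum fun x _ => ?_
        calc |(τ (star (A x μ) * DpZd η U₀ A x μ)).re| ≤ Cτ * ‖A x μ‖ * ‖DpZd η U₀ A x μ‖ := hCτ _ _
          _ ≤ Cτ * ‖A x μ‖ * (K * (∑ τ' : Fin d, (‖A x τ'‖ + ∑ b : Fin d, ‖A (x + e b) τ'‖ + ∑ a : Fin d, ‖A (x - e a) τ'‖ + ∑ a : Fin d, ∑ b : Fin d, ‖A (x - e a + e b) τ'‖))) := mul_le_mul_of_nonneg_left (hpt x μ) (by positivity)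
          _ = Cτ * K * (‖A x μ‖ * (∑ τ' : Fin d, (‖A x τ'‖ + ∑ b : Fin d, ‖A (x + e b) τ'‖ + ∑ a : Fin d, ‖A (x - e a) τ'‖ + ∑ a : Fin d, ∑ b : Fin d, ‖A (x - e a + e b) τ'‖))) := by ring
    _ = Cτ * K * ∑ μ : Fin d, ∑ x ∈ box (d := d) P, ‖A x μ‖ * (∑ τ' : Fin d, (‖A x τ'‖ + ∑ b : Fin d, ‖A (x + e b) τ'‖ + ∑ a : Fin d, ‖A (x - e a) τ'‖ + ∑ a : Fin d, ∑ b : Fin d, ‖A (x - e a + e b) τ'‖)) := by simp only [Finset.mul_sum]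
    _ ≤ Cτ * K * (((d : ℝ) * ((d : ℝ) + 1) ^ 2) * N) := mul_le_mul_of_nonneg_left (sum_norm_mul_nearSum_le P hA) (by positivity)
    _ ≤ Cτ * K * (((d : ℝ) * ((d : ℝ) + 1) ^ 2) * (T / κ)) := by gcongr
    _ = K * ((d : ℝ) * ((d : ℝ) + 1) ^ 2) * (Cτ / κ) * T := by ring

end Schur

/-! ## §2  Theorem 3.11 UNIFORMLY IN THE VOLUME at a commutative coefficient algebra, on the all-torus members -/

section Abelian

variable (τ : 𝔸 →ₗ[ℂ] ℂ) [Nontrivial 𝔸] [FiniteDimensional ℝ 𝔸] (hτp : ∀ b : 𝔸, b ≠ 0 → 0 < (τ (star b * b)).re)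
  (hτt : ∀ b b' : 𝔸, τ (b * b') = τ (b' * b)) (hτs : ∀ b : 𝔸, τ (star b) = starRingEnd ℂ (τ b)) (hcomm : ∀ a b : 𝔸, a * b = b * a) {L : ℕ}

omit [Nontrivial 𝔸] [FiniteDimensional ℝ 𝔸] in
/-- the periodic pairing is additive in the second argument. [cite: Balaban1985BackgroundPropagators, (3.11) p.392 (bookkeeping)] -/
private theorem bondPairPer_add_right (P : ℕ) (A X Y : Site d → Fin d → 𝔸) :
    bondPairPer τ P A (X + Y) = bondPairPer τ P A X + bondPairPer τ P A Y := by
  unfold bondPairPer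
  simp only [Pi.add_apply, mul_add, map_add, Complex.add_re, Finset.sum_add_distrib]

include hτp hτt hτs hcomm in
/-- ★★★ **[B9] THM 3.11 FOR THE GENUINE PERIODIC RECORD AT A COMMUTATIVE COEFFICIENT ALGEBRA, WITH A VOLUME-UNIFORM CONSTANT**: at an all-torus member (`Ω_j = ℤᵈ`,
`Λs m = torusLam m`, class `ΛbP m = torusLamb m`, `η·Lᵐ ≤ 1`), period `P = Lᵐ·n`, a unitary `P`-periodic background in the class `𝔄_m({ℤᵈ}, α₀)` with `0 ≤ α₀ ≤ α_Q∕L²`, and EVERY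
`P`-periodic Hermitian `A`: `(γ − c_D·α₀)·Σ_μΣ_{[0,P)ᵈ} Re τ(A*A) ≤ ⟨A, Δ_a(U₀)A⟩_per`, `γ = (1∕((d+1)Cst d 1))·min(η w_m L^{2m}∕L^{md}, 1)` (dag-n06-w3's flat constant),
`c_D = 14(d−1)(Lᵐη)⁻²·d(d+1)²·C_τ∕κ` — NEITHER depends on the volume `n`.  Proof: `Δ_a(U₀) = Δ_a(1) + Δ′(U₀)` (commutativity) + the flat coercivity + §1.
[cite: Balaban1985BackgroundPropagators, Thm 3.11 p.416 («uniformly in U, Ω_j»), (3.26) p.395, (3.10) p.392, (3.69) p.404; Balaban1984PropagatorsI, Prop. 1.1 (1.90) p.33; Balaban1985RegularSpaces, (1.7) p.77, p.77 («Ω_j = T_η»)] -/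
theorem bondPairPer_deltaAOf_opsAllZdPer_ge_of_comm (hd2 : 2 ≤ d) (hL : 2 ≤ L) {Cτ : ℝ} (hCτ : ∀ x y : 𝔸, |(τ (star x * y)).re| ≤ Cτ * ‖x‖ * ‖y‖)
    {κ : ℝ} (hκ : 0 < κ) (hκle : ∀ a : 𝔸, κ * ‖a‖ ^ 2 ≤ (τ (star a * a)).re)
    {ΛbP : ℕ → ℕ → Set (Site d × Fin d)} {m n : ℕ} [NeZero (L ^ m * n)] (hΛb : ΛbP m = B8Thm2TorusMember.torusLamb m)
    (ops₀ : ℝ → ZdIdx d L → ℕ → OpsZd d 𝔸) (M : ℝ) (i : ZdIdx d L) (hΩ : ∀ j, i.Ω j = Set.univ) (hηL : i.η * (L ^ m : ℕ) ≤ 1)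
    (hΛs : i.Λs m = B8Thm4TorusAt.torusLam m) {α₀ : ℝ} (hα0 : 0 ≤ α₀) (hαQ : α₀ ≤ alphaQ d L / (L : ℝ) ^ 2)
    {U₀ : Site d → Fin d → 𝔸ˣ} (hU₀ : ∀ x κ', U₀ x κ' ∈ unitaryUnits 𝔸) (hIn : InAk L m i.η α₀ i.Ω U₀)
    {A : Site d → Fin d → 𝔸} (hAper : IsPeriodic (L ^ m * n) A) (hAherm : ∀ w μ, IsSelfAdjoint (A w μ)) :
    ((1 / ((d + 1 : ℝ) * B5Prop11Plancherel.Cst d 1)) * min (i.η * wQ (d := d) L i.η m * ((L : ℝ) ^ m) ^ 2 / (((L ^ m : ℕ) : ℝ) ^ d)) 1 -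
        (14 * ((d - 1 : ℕ) : ℝ)) * α₀ * (((L : ℝ) ^ m * i.η) ^ 2)⁻¹ * ((d : ℝ) * ((d : ℝ) + 1) ^ 2) * (Cτ / κ)) *
        (∑ μ : Fin d, ∑ z ∈ box (d := d) (L ^ m * n), (τ (star (A z μ) * A z μ)).re) ≤
      bondPairPer τ (L ^ m * n) A (deltaAOf i.η (opsAllZdPer τ L (L ^ m * n) ΛbP ops₀ M i m) U₀ A) := by
  have hd : 0 < d := lt_of_lt_of_le (by norm_num) hd2
  haveI : NeZero L := ⟨by omega⟩
  haveI : NeZero n := ⟨fun h => (NeZero.ne (L ^ m * n)) (by rw [h, mul_zero])⟩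
  have hreg : Reg17 L m i.Ω (alphaQ d L / (L : ℝ) ^ 2) U₀ := reg17_mono hαQ (reg17_of_inAk hIn le_rfl)
  have hplaq : ∀ (y : Site d) (κ' ν : Fin d), κ' ≠ ν → ‖plaqF U₀ κ' ν y - 1‖ ≤ α₀ * (((L : ℝ) ^ m)⁻¹) ^ 2 := fun y κ' ν hκν =>
    ((hIn m le_rfl).1 y κ' ν hκν (Or.inl (by rw [hΩ]; exact Set.mem_univ y))).le
  rw [deltaAOf_opsAllZdPer_eq_one_add_DpZd_of_comm hcomm τ (L ^ m * n) ΛbP ops₀ M hd hL hΩ m hU₀ hreg A, bondPairPer_add_right, sub_mul]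
  have h1 := bondPairPer_deltaAOf_opsAllZdPer_one_ge τ m n hτs hτp hτt hL hΛb ops₀ M i hηL hΛs hAper hAherm
  have h2 := abs_bondPairPer_DpZd_le (L ^ m * n) τ hCτ hκ hκle (η := i.η) hα0 hU₀ hplaq hAper
  have h2' := neg_le_of_abs_le h2
  linarith

/-- the volume-uniform threshold of the abelian Theorem 3.11: `a_ab = min{α_Q∕L², γ∕(2c_D′)}` with `c_D′ = c_D∕α₀` the slope of the curvature bound. [cite: Balaban1985BackgroundPropagators, Thm 3.11 p.416 («for … α₀ sufficiently small»)] -/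
private theorem threshold_arith {γ c a : ℝ} (hγ : 0 < γ) (hc : 0 < c) (ha : a ≤ γ / (2 * c)) : γ / 2 ≤ γ - c * a := by
  have : c * a ≤ γ / 2 := by
    calc c * a ≤ c * (γ / (2 * c)) := mul_le_mul_of_nonneg_left ha hc.le
      _ = γ / 2 := by field_simp
  linarith

include hτp hτt hτs hcomm in
/-- ★★★★ **THEOREM 3.11 ON THE TORUS, VOLUME-UNIFORMLY, AT A COMMUTATIVE ALGEBRA — THE REGIME**: with the P-FREE threshold
`a_ab = min{α_Q∕L², γ∕(2·14(d−1)(Lᵐη)⁻²d(d+1)²C_τ∕κ)}`, at EVERY period `P = Lᵐ·n` and EVERY unitary `P`-periodic `U₀ ∈ 𝔄_m({ℤᵈ}, α₀)`, `α₀ ≤ a_ab`, the genuine record's `Δ_a(U₀)`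
is invertible on `E_𝔤^per(P)` (`RegularAtHPer`) — with the coercivity constant `γ∕2` — and `InvAtHIPer P L (opsAllZdPer …) a_ab M i m` HOLDS (the N05 head's `hinv` at the member with a
threshold that does NOT depend on the volume).  SPECIAL CASE commutative `𝔸` (the programme's record `ℂ`); NOT the non-abelian theorem.
[cite: Balaban1985BackgroundPropagators, Thm 3.11 p.416, (3.26)–(3.27) p.395; Balaban1985RegularSpaces, (1.7) p.77, (1.58) p.86, p.77 («Ω_j = T_η»)] -/
theorem invAtHIPer_opsAllZdPer_of_comm (hd2 : 2 ≤ d) (hL : 2 ≤ L) {Cτ : ℝ} (hCτ : ∀ x y : 𝔸, |(τ (star x * y)).re| ≤ Cτ * ‖x‖ * ‖y‖)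
    {κ : ℝ} (hκ : 0 < κ) (hκle : ∀ a : 𝔸, κ * ‖a‖ ^ 2 ≤ (τ (star a * a)).re)
    {ΛbP : ℕ → ℕ → Set (Site d × Fin d)} {m n : ℕ} [NeZero (L ^ m * n)] (hΛb : ΛbP m = B8Thm2TorusMember.torusLamb m)
    (ops₀ : ℝ → ZdIdx d L → ℕ → OpsZd d 𝔸) (M : ℝ) (i : ZdIdx d L) (hΩ : ∀ j, i.Ω j = Set.univ) (hηL : i.η * (L ^ m : ℕ) ≤ 1)
    (hΛs : i.Λs m = B8Thm4TorusAt.torusLam m) {aab : ℝ} (haQ : aab ≤ alphaQ d L / (L : ℝ) ^ 2)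
    (haγ : aab ≤ ((1 / ((d + 1 : ℝ) * B5Prop11Plancherel.Cst d 1)) * min (i.η * wQ (d := d) L i.η m * ((L : ℝ) ^ m) ^ 2 / (((L ^ m : ℕ) : ℝ) ^ d)) 1) /
      (2 * ((14 * ((d - 1 : ℕ) : ℝ)) * (((L : ℝ) ^ m * i.η) ^ 2)⁻¹ * ((d : ℝ) * ((d : ℝ) + 1) ^ 2) * (Cτ / κ)))) :
    RegularInClassAtHPer (L ^ m * n) L (opsLandauPer τ (L ^ m * n) (withDpZd (withQQP τ L ΛbP ops₀))) aab M i m ∧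
      InvAtHIPer (L ^ m * n) L (opsAllZdPer τ L (L ^ m * n) ΛbP ops₀) aab M i m := by
  have hL1 : 1 ≤ L := le_trans one_le_two hL
  have hd : 0 < d := lt_of_lt_of_le (by norm_num) hd2
  haveI : NeZero L := ⟨by omega⟩
  haveI : NeZero n := ⟨fun h => (NeZero.ne (L ^ m * n)) (by rw [h, mul_zero])⟩
  have hnn : ∀ a : 𝔸, 0 ≤ (τ (star a * a)).re := fun a => by
    by_cases h : a = 0
    · simp [h]
    · exact (hτp a h).le
  -- positivity of the flat constant and of the curvature slope
  have hC1 : (1 : ℝ) ≤ B5Prop11Plancherel.Cst d 1 := le_trans (le_max_right _ _) (le_max_right _ _)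
  have hγ : 0 < (1 / ((d + 1 : ℝ) * B5Prop11Plancherel.Cst d 1)) * min (i.η * wQ (d := d) L i.η m * ((L : ℝ) ^ m) ^ 2 / (((L ^ m : ℕ) : ℝ) ^ d)) 1 := by
    have hw : 0 < i.η * wQ (d := d) L i.η m := mul_pos i.hη (B9Thm311FlatHermKernelZd.wQ_pos hL1 i.hη m)
    have hLpos : (0 : ℝ) < ((L ^ m : ℕ) : ℝ) ^ d := by positivity
    have : 0 < min (i.η * wQ (d := d) L i.η m * ((L : ℝ) ^ m) ^ 2 / (((L ^ m : ℕ) : ℝ) ^ d)) 1 := lt_min (by positivity) one_pos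
    positivity
  have hCτ0 : 0 < Cτ := by
    have h := hCτ 1 1
    simp only [norm_one, mul_one, star_one] at h
    have hκ1 := hκle 1
    simp only [norm_one, one_pow, mul_one, star_one] at hκ1
    exact lt_of_lt_of_le (lt_of_lt_of_le hκ hκ1) (le_trans (le_abs_self _) h)
  have hdm1 : (1 : ℝ) ≤ ((d - 1 : ℕ) : ℝ) := by exact_mod_cast (show 1 ≤ d - 1 by omega)
  have hc : 0 < (14 * ((d - 1 : ℕ) : ℝ)) * (((L : ℝ) ^ m * i.η) ^ 2)⁻¹ * ((d : ℝ) * ((d : ℝ) + 1) ^ 2) * (Cτ / κ) := by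
    have := i.hη; positivity
  -- the regime at every class background, period by period
  have hregime : RegularInClassAtHPer (L ^ m * n) L (opsLandauPer τ (L ^ m * n) (withDpZd (withQQP τ L ΛbP ops₀))) aab M i m := by
    intro α₀ U₀ hU₀ hU hα hIn
    -- `α₀ ≥ 0` (else the class is empty: there is a plaquette, `d ≥ 2`)
    have hα0 : 0 ≤ α₀ := by
      by_contra hneg
      have hneg : α₀ < 0 := lt_of_not_ge hneg
      have h := (hIn 0 (Nat.zero_le _)).1 0 ⟨0, hd⟩ ⟨1, hd2⟩ (by simp [Fin.ext_iff]) (Or.inl (by rw [hΩ]; exact Set.mem_univ _))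
      have : α₀ * (((L : ℝ) ^ 0)⁻¹) ^ 2 < 0 := by rw [pow_zero, inv_one, one_pow, mul_one]; exact hneg
      linarith [norm_nonneg (plaqF U₀ ⟨0, hd⟩ ⟨1, hd2⟩ 0 - 1)]
    refine regularAtHPer_opsAllZdPer_of_pos τ (L ^ m * n) hL hτp hτt hτs ΛbP ops₀ M i hU₀ hU (Dvd.intro n rfl)
      (fun j _ κ' => by rw [hΛb]; exact B9Thm311FlatPositivityZdPer.isPeriodic_mem_torusLamb (L ^ m * n / L ^ j) m j κ')
      (fun j _ _ _ _ x _ => by rw [hΩ]; exact Set.mem_univ x) fun A hA hA0 => ?_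
    have hcoer := bondPairPer_deltaAOf_opsAllZdPer_ge_of_comm τ hτp hτt hτs hcomm hd2 hL hCτ hκ hκle hΛb ops₀ M i hΩ hηL hΛs hα0 (hα.trans haQ)
      hU₀ hIn hA.1 hA.2
    -- a non-zero periodic field has a positive cell energy
    have hpos : 0 < ∑ μ : Fin d, ∑ z ∈ box (d := d) (L ^ m * n), (τ (star (A z μ) * A z μ)).re := by
      have hA0' : ∃ z ∈ box (d := d) (L ^ m * n), ∃ μ : Fin d, A z μ ≠ 0 := by
        by_contra hcon
        apply hA0
        funext x μ
        have hx : A (tlift (tcls (L ^ m * n) x)) μ = 0 := by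
          by_contra h1
          exact hcon ⟨_, tlift_mem_box _, μ, h1⟩
        rw [show A (tlift (tcls (L ^ m * n) x)) = A x from hA.1.apply_tlift x] at hx
        exact hx
      obtain ⟨z, hz, μ, hzμ⟩ := hA0'
      calc (0 : ℝ) < (τ (star (A z μ) * A z μ)).re := hτp _ hzμ
        _ ≤ ∑ z' ∈ box (d := d) (L ^ m * n), (τ (star (A z' μ) * A z' μ)).re :=
            Finset.single_le_sum (f := fun z' => (τ (star (A z' μ) * A z' μ)).re) (fun z' _ => hnn _) hz
        _ ≤ ∑ μ' : Fin d, ∑ z' ∈ box (d := d) (L ^ m * n), (τ (star (A z' μ') * A z' μ')).re :=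
            Finset.single_le_sum (f := fun μ' => ∑ z' ∈ box (d := d) (L ^ m * n), (τ (star (A z' μ') * A z' μ')).re)
              (fun μ' _ => Finset.sum_nonneg fun z' _ => hnn _) (Finset.mem_univ μ)
    have hslope := threshold_arith hγ hc (hα.trans haγ)
    nlinarith
  exact ⟨hregime, invAtHIPer_withGopZdHPer (L ^ m * n) (opsLandauPer τ (L ^ m * n) (withDpZd (withQQP τ L ΛbP ops₀))) M i m (hΩ 0) hregime⟩

end Abelian

end Literature.MathematicalPhysics.QuantumFieldTheory.Balaban1983to89.B9Thm311AbelianUniformZdPer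

end
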